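import Literature.NumberTheory.Automorphic.ArthurClozelBaseChangeProofs
import Literature.NumberTheory.Automorphic.NormGroupIndex
import Literature.NumberTheory.GaloisRepresentations.UnitsHerbrand
import HarnessLib

/-!
# Arthur–Clozel, Ch. 3, Thm. 4.2 (b), clause `ℓ ∣ n`: discharged (first inequality, no hypotheses)

Topic `NumberTheory/Automorphic`; namespace `Literature.NumberTheory.Automorphic`. Proof file
(theorems only: no definition, no named fact, no instance), sequel to
`ArthurClozelBaseChangeProofs` and `NormGroupIndex`. It **discharges the named fact
`ArthurClozel1989_dvd_of_twist_eq`** (`ArthurClozelBaseChange`; Arthur–Clozel, *Simple algebras,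
base change, and the advanced theory of the trace formula*, Ann. of Math. Stud. 120 (1989), Ch. 3,
Thm. 4.2 (b): for `E/F` cyclic of prime degree `ℓ` with class-field character `η` and `π` cuspidal
on `GL_n(𝔸_F)`, `n ≥ 1`, with `π ≅ π ⊗ η`, the lift is `Π₁ × ⋯ × Π₁^{σ^{ℓ-1}}` with `Π₁` on
`GL(n/ℓ, 𝔸_E)` — in particular `ℓ ∣ n`, the clause rendered by the fact).

The tree already proved the two halves of the clause:

* `π ⊗ η = π ⇒ ord(η) ∣ n` unconditionally
  (`CuspidalAutomorphicRepGL.orderOf_dvd_of_twistByFiniteOrderChar_eq`, `ArthurClozelBaseChangeProofs`: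
  `ηⁿ = 1` at almost all uniformizers by the Satake identity `t_{π ⊗ η,v} = η(ϖ_v) t_{π,v}`, then
  weak approximation), whence the reduction
  `arthurClozel1989_dvd_of_twist_eq_of_normGroup_ne_top : normGroup F E ≠ ⊤ → …`;
* the **first inequality of class field theory for cyclic extensions, idelic form, with no
  hypotheses**: `[E : F] ≤ [𝕀_F : Fˣ N_{E/F} 𝕀_E]`
  (`IdeleHerbrand.finrank_le_index_normGroup_of_isCyclic`, `GaloisRepresentations/UnitsHerbrand`;
  Childress, *Class Field Theory*, Ch. 4 §5 Thm. 5.11–5.12 = Tate, Ch. VII of Cassels–Fröhlich,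
  §8 Thm. 8.3 / Consequence 8.4, via the Herbrand quotient of `C_E`).

Here they are combined:

* `normGroup_ne_top_of_isCyclic` — for `E/F` cyclic with `E ≠ F`, `Fˣ N_{E/F}(𝕀_E) ≠ 𝕀_F`
  (Tate §8, Consequence 8.5, idelic form), unconditionally;
* `HeckeCharacter.IsClassFieldCharacter.orderOf_eq_finrank_of_prime` — every class-field character
  of a Galois extension of prime degree `ℓ` has order exactly `ℓ`, unconditionally (the form in
  which Thm. 4.2 (b) uses class field theory; previously available only relative to
  `exists_isClassFieldCharacter`, `normGroup F E ≠ ⊤` or the first inequality as a hypothesis);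
* **`ArthurClozel1989_dvd_of_twist_eq_holds : ArthurClozel1989_dvd_of_twist_eq n F E`** — the
  discharge.

## References

* J. Arthur, L. Clozel, *Simple algebras, base change, and the advanced theory of the trace
  formula*, Ann. of Math. Stud. 120 (1989), Ch. 3, §4, Thm. 4.2 (b) and its proof
  ("Thus `n_u = n/l`"). [ArthurClozelAMS120]
* J. Tate, *Global class field theory*, Ch. VII of J. W. S. Cassels, A. Fröhlich (eds.),
  *Algebraic Number Theory* (1967), §8, Thm. 8.3, Consequences 8.4–8.5. [TateGCFT1967]
  [CasselsFrohlichANT1967]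
* N. Childress, *Class Field Theory*, Universitext (2009), Ch. 4 §5, Thm. 5.11–5.12. [Childress2009]
-/

noncomputable section

namespace Literature.NumberTheory.Automorphic

open NumberField MeasureTheory AdelicGroupData
open Literature.NumberTheory.GaloisRepresentations

variable {F E : Type} [Field F] [NumberField F] [Field E] [NumberField E] [Algebra F E]
  [FiniteDimensional F E]

/-- **The norm group of a non-trivial cyclic extension is proper** (Tate, Ch. VII of
Cassels–Fröhlich, §8, Consequence 8.5, idelic form; no hypotheses): for `E/F` cyclic with
`[E : F] > 1`, `Fˣ N_{E/F}(𝕀_E) ≠ 𝕀_F`, from the first inequality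
`[E : F] ≤ [𝕀_F : Fˣ N_{E/F} 𝕀_E]` (`IdeleHerbrand.finrank_le_index_normGroup_of_isCyclic`).
[cite: TateGCFT1967, §8 Consequences 8.4–8.5] -/
theorem normGroup_ne_top_of_isCyclic [IsGalois F E] (hcyc : IsCyclic (E ≃ₐ[F] E))
    (hEF : 1 < Module.finrank F E) : normGroup F E ≠ ⊤ :=
  normGroup_ne_top_of_finrank_le_index (IdeleHerbrand.finrank_le_index_normGroup_of_isCyclic hcyc) hEF

/-- **A class-field character of a Galois extension of prime degree `ℓ` has order exactly `ℓ`**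
(unconditionally): `η ^ ℓ = 1` since `ℓ`-th powers are norms, and `η ≠ 1` since the norm group is
proper (`normGroup_ne_top_of_isCyclic`, the Galois group of prime order being cyclic); this is
`IsClassFieldCharacter.orderOf_eq_finrank_of_normGroup_ne_top` with its hypothesis discharged.
[cite: TateGCFT1967, §8 Consequence 8.4] -/
theorem _root_.Literature.NumberTheory.GaloisRepresentations.HeckeCharacter.IsClassFieldCharacter.orderOf_eq_finrank_of_prime
    [IsGalois F E] (hℓ : (Module.finrank F E).Prime) {η : HeckeCharacter F}
    (hη : η.IsClassFieldCharacter E) : orderOf η = Module.finrank F E :=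
  haveI : Fact (Module.finrank F E).Prime := ⟨hℓ⟩
  IsClassFieldCharacter.orderOf_eq_finrank_of_normGroup_ne_top
    (normGroup_ne_top_of_isCyclic (isCyclic_of_prime_card (IsGalois.card_aut_eq_finrank F E))
      hℓ.one_lt) hℓ hη

variable (n : ℕ) (F E)

/-- **Arthur–Clozel, Ch. 3, Thm. 4.2 (b), clause `ℓ ∣ n` — discharged.** For `E/F` Galois of prime
degree `ℓ` (hence cyclic), `η` a class-field character and `π` cuspidal on `GL_n(𝔸_F)`, `n ≥ 1`,
with `π ⊗ η = π`: `ord(η) ∣ n` (`CuspidalAutomorphicRepGL.orderOf_dvd_of_twistByFiniteOrderChar_eq`)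
and `ord(η) = ℓ` (first inequality, `normGroup_ne_top_of_isCyclic`), through
`arthurClozel1989_dvd_of_twist_eq_of_normGroup_ne_top`.
[cite: ArthurClozelAMS120, Ch. 3, Thm. 4.2 (b)] -/
theorem ArthurClozel1989_dvd_of_twist_eq_holds : ArthurClozel1989_dvd_of_twist_eq n F E := by
  intro _ hn hℓ η hη μ _ P hP
  haveI : Fact (Module.finrank F E).Prime := ⟨hℓ⟩
  exact arthurClozel1989_dvd_of_twist_eq_of_normGroup_ne_top
    (normGroup_ne_top_of_isCyclic (isCyclic_of_prime_card (IsGalois.card_aut_eq_finrank F E))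
      hℓ.one_lt) hn hℓ η hη μ P hP

end Literature.NumberTheory.Automorphic
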